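import Summits.Schanuel.Schanuel.Theses.RootDecomp1

/-!
# Schanuel / RootDecomp1 — the split glue `DefectOneSchanuel → SaturatedEssentialSchanuel → NoEssentialCounterexampleGeThreeInEcl`

Route `route-Schanuel-RootDecomp1` (root decomposition cell `decomp-schanuel`, lens-1 node v3
«DefectSaturation»), glue item `stmt-Schanuel-25706` `NoEssentialCounterexampleGeThreeInEclGlue` of the
split of the residual `NoEssentialCounterexampleGeThreeInEcl` (stmt-Schanuel-24394) into
`DefectOneSchanuel` (stmt-Schanuel-25020) and `SaturatedEssentialSchanuel` (stmt-Schanuel-25705).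

THE ARGUMENT (extendable-or-saturated dichotomy, one padding step, no submodularity): let `z` be a
ℚ-linearly independent `n`-tuple, `n ≥ 3`, inside `ecl ∅`, span-minimal, with `trdeg ℚ(z, e^z) < n` to be
excluded.  If `z` is saturated, `SaturatedEssentialSchanuel` gives `n ≤ trdeg` directly.  Otherwise some
`w ∉ span_ℚ z` has `w` and `e^w` algebraic over `F_z = ℚ(z, e^z)`; then `(w, z)` is ℚ-l.i. of length `n + 1`
and `F_{(w,z)}` is algebraic over `F_z`, so `DefectOneSchanuel` at `(w, z)` gives
`n + 1 ≤ trdeg F_{(w,z)} + 1 = trdeg F_z + 1`, i.e. `n ≤ trdeg F_z`.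
Kernel-checked in the node file `HOME/decomp-schanuel-lens-1/v3/DefectSaturation.lean` (critic CLEARED
2026-08-30T02:42:49Z); this file re-proves it against the route's own declarations (item stmt-Schanuel-25706,
an ASIDE of route-Schanuel-RootDecomp1 since rev 7 but still open and closable). Port landed by the census seat (gen 4); 0 sorry.
-/

noncomputable section

set_option linter.dupNamespace false

open Complex IntermediateField

namespace Summit.Schanuel.Schanuel.Theorems.RootDecomp1DefectSplit

open Summit.Schanuel.Schanuel.Theses.RootDecomp1 (DefectOneSchanuel SaturatedEssentialSchanuel
  NoEssentialCounterexampleGeThreeInEcl NoEssentialCounterexampleGeThreeInEclGlue)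

set_option synthInstance.maxHeartbeats 200000 in
/-- `ℚ(T)` with `T` algebraic over an intermediate field `K` has `trdeg_ℚ ℚ(T) ≤ trdeg_ℚ K`
(tower law + `trdeg` of an algebraic extension is 0). [folklore; same lemma as lens-2 `DefectLattice`] -/
theorem trdeg_adjoin_le_of_isAlgebraic (K : IntermediateField ℚ ℂ) {T : Set ℂ}
    (hT : ∀ x ∈ T, IsAlgebraic K x) :
    Algebra.trdeg ℚ ↥(adjoin ℚ T) ≤ Algebra.trdeg ℚ ↥K := by
  have hle : adjoin ℚ T ≤ adjoin ℚ ((K : Set ℂ) ∪ T) := adjoin.mono ℚ _ _ Set.subset_union_right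
  -- monotonicity of `trdeg` along the inclusion (the landed one-liner `DiazLadder.trdeg_adjoin_mono`, inlined)
  have hmono : Algebra.trdeg ℚ ↥(adjoin ℚ T) ≤ Algebra.trdeg ℚ ↥(adjoin ℚ ((K : Set ℂ) ∪ T)) :=
    trdeg_le_of_injective (inclusion hle) (inclusion_injective hle)
  refine hmono.trans (le_of_eq ?_)
  haveI : Algebra.IsAlgebraic K (adjoin K T) :=
    isAlgebraic_adjoin fun x hx => (hT x hx).isIntegral
  have h := trdeg_add_eq ℚ K (A := adjoin K T)
  rw [trdeg_eq_zero (R := K) (A := adjoin K T), add_zero] at h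
  have e := (equivOfEq (restrictScalars_adjoin ℚ K T)).symm.trdeg_eq
  calc Algebra.trdeg ℚ ↥(adjoin ℚ ((K : Set ℂ) ∪ T))
      = Algebra.trdeg ℚ ↥((adjoin K T).restrictScalars ℚ) := e
    _ = Algebra.trdeg ℚ ↥(adjoin K T) := rfl
    _ = Algebra.trdeg ℚ ↥K := h.symm

/-- Generators are algebraic over the generated field. -/
theorem isAlgebraic_of_mem_gens {S : Set ℂ} {x : ℂ} (hx : x ∈ S) :
    IsAlgebraic ↥(adjoin ℚ S) x :=
  isAlgebraic_algebraMap (⟨x, subset_adjoin ℚ S hx⟩ : ↥(adjoin ℚ S))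

/-- THE PADDING STEP.  If `z` is ℚ-l.i. of length `n` and `w ∉ span_ℚ z` has `w, e^w` algebraic over
`F_z`, then one-defect Schanuel at the (n+1)-tuple `(w, z)` gives `n ≤ trdeg F_z`. -/
theorem le_trdeg_of_extension (hD : DefectOneSchanuel) {n : ℕ} {z : Fin n → ℂ}
    (hz : LinearIndependent ℚ z) {w : ℂ}
    (hw1 : IsAlgebraic ↥(adjoin ℚ (Set.range z ∪ Set.range (Complex.exp ∘ z))) w)
    (hw2 : IsAlgebraic ↥(adjoin ℚ (Set.range z ∪ Set.range (Complex.exp ∘ z))) (Complex.exp w))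
    (hw3 : w ∉ Submodule.span ℚ (Set.range z)) :
    (n : Cardinal) ≤ Algebra.trdeg ℚ ↥(adjoin ℚ (Set.range z ∪ Set.range (Complex.exp ∘ z))) := by
  set K : IntermediateField ℚ ℂ := adjoin ℚ (Set.range z ∪ Set.range (Complex.exp ∘ z)) with hK
  have hli : LinearIndependent ℚ (Fin.cons w z : Fin (n + 1) → ℂ) :=
    linearIndependent_finCons.mpr ⟨hz, hw3⟩
  have h1 := hD (n + 1) (Fin.cons w z) hli
  have hgens : ∀ x ∈ Set.range (Fin.cons w z : Fin (n + 1) → ℂ) ∪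
      Set.range (Complex.exp ∘ (Fin.cons w z : Fin (n + 1) → ℂ)), IsAlgebraic ↥K x := by
    rintro x (⟨i, rfl⟩ | ⟨i, rfl⟩)
    · refine Fin.cases ?_ (fun j => ?_) i
      · simpa using hw1
      · simp only [Fin.cons_succ]
        exact isAlgebraic_of_mem_gens (Or.inl ⟨j, rfl⟩)
    · refine Fin.cases ?_ (fun j => ?_) i
      · simpa using hw2
      · simp only [Function.comp_apply, Fin.cons_succ]
        exact isAlgebraic_of_mem_gens (Or.inr ⟨j, rfl⟩)
  have h2 := trdeg_adjoin_le_of_isAlgebraic K hgens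
  have h3 : ((n + 1 : ℕ) : Cardinal) ≤ Algebra.trdeg ℚ ↥K + 1 := h1.trans (add_le_add h2 le_rfl)
  have h4 : ((n + 1 : ℕ) : Cardinal) = (n : Cardinal) + 1 := by push_cast; rfl
  rw [h4] at h3
  exact (Cardinal.add_le_add_iff_of_lt_aleph0 Cardinal.one_lt_aleph0).mp h3

/-- `B → C → X3e`: a span-minimal counterexample of dimension ≥ 3 in `ecl ∅` is either saturated —
excluded by `SaturatedEssentialSchanuel` — or extendable by an exponential-algebraic point — excluded by
`DefectOneSchanuel` (`le_trdeg_of_extension`). -/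
theorem noEss_of_defectOne_satEss (hD : DefectOneSchanuel) (hC : SaturatedEssentialSchanuel) :
    NoEssentialCounterexampleGeThreeInEcl := by
  intro n hn z hz hecl hgen
  by_cases hsat : ∀ w : ℂ, IsAlgebraic ↥(adjoin ℚ (Set.range z ∪ Set.range (Complex.exp ∘ z))) w →
      IsAlgebraic ↥(adjoin ℚ (Set.range z ∪ Set.range (Complex.exp ∘ z))) (Complex.exp w) →
      w ∈ Submodule.span ℚ (Set.range z)
  · exact hC n hn z hz hecl hgen hsat
  · push Not at hsat
    obtain ⟨w, hw1, hw2, hw3⟩ := hsat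
    exact le_trdeg_of_extension hD hz hw1 hw2 hw3

/-- Settles the glue item `stmt-Schanuel-25706`: `NoEssentialCounterexampleGeThreeInEclGlue`
(`DefectOneSchanuel → SaturatedEssentialSchanuel → NoEssentialCounterexampleGeThreeInEcl`). -/
theorem noEssentialCounterexampleGeThreeInEclGlue_holds : NoEssentialCounterexampleGeThreeInEclGlue :=
  fun hD hC => noEss_of_defectOne_satEss hD hC

end Summit.Schanuel.Schanuel.Theorems.RootDecomp1DefectSplit

end
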